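import Summits.QuantumAdvantage.AdviceFreeQNC0.WalkTransport
import HarnessLib

/-!
# Cell qa-qnc0 — block complements of walk bits flip exactly the two boundary input bits
(planner qa-qnc0-p1 g36; answers p2's P-34c′ and is step (β) of ROUND-35 §4.10 (7).)

`blockCompl u a b` complements the walk bits `u_a, …, u_{b−1}`.  In input coordinates `x_i = [u_{i−1} = u_i]`
(`xOfU`, conventions `u_{−1} = 0`, `u_n = 1`) this flips `x_a` and `x_b` and nothing else (`0 ≤ a < b ≤ n`).
-/

namespace Summit.QuantumAdvantage.AdviceFreeQNC0

namespace Comb37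

variable {n : ℕ}

/-- complement the walk bits on `[a, b)`. -/
def blockCompl (u : Fin n → Bool) (a b : ℕ) : Fin n → Bool :=
  fun i => if a ≤ i.val ∧ i.val < b then !u i else u i

/-- Inside the block (and below `n`) the extended input is negated. -/
theorem uExt_blockCompl_of_mem (u : Fin n → Bool) {a b k : ℕ} (hk : a ≤ k ∧ k < b) (hkn : k < n) :
    uExt (blockCompl u a b) k = !uExt u k := by
  unfold uExt blockCompl
  rw [dif_pos hkn, dif_pos hkn]
  simp only
  rw [if_pos hk]

/-- Outside the block the extended input is unchanged. -/
theorem uExt_blockCompl_of_not_mem (u : Fin n → Bool) {a b k : ℕ} (hk : ¬ (a ≤ k ∧ k < b)) :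
    uExt (blockCompl u a b) k = uExt u k := by
  unfold uExt blockCompl
  by_cases hkn : k < n
  · rw [dif_pos hkn, dif_pos hkn]
    simp only
    rw [if_neg hk]
  · rw [dif_neg hkn, dif_neg hkn]

/-- **interior and exterior input bits are unchanged.** -/
theorem xOfU_blockCompl_of_ne (u : Fin n → Bool) {a b : ℕ} (hbn : b ≤ n) {i : Fin (n + 1)} (hia : i.val ≠ a)
    (hib : i.val ≠ b) : xOfU (blockCompl u a b) i = xOfU u i := by
  unfold xOfU
  by_cases hi0 : i.val = 0
  · rw [if_pos hi0, if_pos hi0]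
    have : ¬ (a ≤ i.val ∧ i.val < b) := by omega
    rw [uExt_blockCompl_of_not_mem u this]
  · rw [if_neg hi0, if_neg hi0]
    by_cases hin : a ≤ i.val ∧ i.val < b
    · -- interior: both `u_i` and `u_{i-1}` are complemented
      have hin' : a ≤ i.val - 1 ∧ i.val - 1 < b := by omega
      rw [uExt_blockCompl_of_mem u hin (by omega), uExt_blockCompl_of_mem u hin' (by omega)]
      cases uExt u i.val <;> cases uExt u (i.val - 1) <;> rfl
    · have hout' : ¬ (a ≤ i.val - 1 ∧ i.val - 1 < b) := by omega
      rw [uExt_blockCompl_of_not_mem u hin, uExt_blockCompl_of_not_mem u hout']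

/-- **the left boundary bit `x_a` flips.** -/
theorem xOfU_blockCompl_left (u : Fin n → Bool) {a b : ℕ} (hab : a < b) (hbn : b ≤ n) {i : Fin (n + 1)}
    (hia : i.val = a) : xOfU (blockCompl u a b) i = !xOfU u i := by
  unfold xOfU
  have hin : a ≤ i.val ∧ i.val < b := by omega
  rw [uExt_blockCompl_of_mem u hin (by omega)]
  by_cases hi0 : i.val = 0
  · rw [if_pos hi0, if_pos hi0]
    cases uExt u i.val <;> rfl
  · rw [if_neg hi0, if_neg hi0]
    have hout : ¬ (a ≤ i.val - 1 ∧ i.val - 1 < b) := by omega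
    rw [uExt_blockCompl_of_not_mem u hout]
    cases uExt u i.val <;> cases uExt u (i.val - 1) <;> rfl

/-- **the right boundary bit `x_b` flips** (`b = n` allowed: `x_n = [u_{n−1} = 1]`). -/
theorem xOfU_blockCompl_right (u : Fin n → Bool) {a b : ℕ} (hab : a < b) (hbn : b ≤ n) {i : Fin (n + 1)}
    (hib : i.val = b) : xOfU (blockCompl u a b) i = !xOfU u i := by
  unfold xOfU
  have hout : ¬ (a ≤ i.val ∧ i.val < b) := by omega
  rw [uExt_blockCompl_of_not_mem u hout]
  have hi0 : i.val ≠ 0 := by omega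
  rw [if_neg hi0, if_neg hi0]
  have hin : a ≤ i.val - 1 ∧ i.val - 1 < b := by omega
  rw [uExt_blockCompl_of_mem u hin (by omega)]
  cases uExt u i.val <;> cases uExt u (i.val - 1) <;> rfl

/-- walk bits outside the block are unchanged (so every `sg(u_p)` with `p ∉ [a,b)` is invariant). -/
theorem blockCompl_apply_of_not_mem (u : Fin n → Bool) {a b : ℕ} {i : Fin n} (hi : ¬ (a ≤ i.val ∧ i.val < b)) :
    blockCompl u a b i = u i := by
  unfold blockCompl; rw [if_neg hi]

/-- A block complement is an involution. -/
theorem blockCompl_blockCompl (u : Fin n → Bool) (a b : ℕ) : blockCompl (blockCompl u a b) a b = u := by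
  funext i
  unfold blockCompl
  by_cases h : a ≤ i.val ∧ i.val < b
  · rw [if_pos h, if_pos h, Bool.not_not]
  · rw [if_neg h, if_neg h]

end Comb37

end Summit.QuantumAdvantage.AdviceFreeQNC0
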